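import Summits.QuantumAdvantage.QuantumAdvantage.Theorems.SymplecticPurityDlogGraphFlatFlankA
import Literature.Combinatorics.Additive.TripleProductCount

/-!
# Crux `DlogGraphFlat` (stmt-QuantumAdvantage-10732), line `Sketch` — band differentials, part A

The band route for the XOR-differential counts `D(a,a')` of the DLOG S-box `x ↦ bits (gˣ mod p)`
(sector A of the crux, band `|a| ≈ |a'| ≈ n/2`). With `W = ofBits (x ∧ a)`, `V = ofBits (x ∧ ā)`
and the differential equation in the normalised form
`g^{ofBits (x ⊕ a)} − ε g^{ofBits x} = c + (B − 2·ofBits (q x ∧ b))` (`ε = ±1`; direct form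
`b = a'`, complemented form `b = ā'`), the map `x ↦ (x ∧ a, x ∧ ā, q x ∧ b)` injects the
differential set, off the exceptional multiplier classes `g^A = ±(g^W)²`, into the solutions of
`z · φ(w) = s(u)` with `φ(w) = g^A (g^W)⁻¹ − ε g^W`, `z = g^V`, `s(u) = c + (B − 2 ofBits u)` —
the registered stub `stub_dlogBandCount`. The abstract Cauchy–Schwarz engine
(`Literature.Combinatorics.Additive.triple_count_pow_four_le`) then bounds that triple count by the
index-level multiplicative energy of the signed-digit spread set (`band_triple_pow_four_le`, both
orderings). Part B turns this into `stub_dlogBandReduction` (spread-set energy ⇒ band bound).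
-/

set_option linter.dupNamespace false -- D-0017: single-problem summit ⇒ `QuantumAdvantage.QuantumAdvantage` by design

namespace Summit.QuantumAdvantage.QuantumAdvantage.Theorems.SymplecticPurity

open Finset Literature.Combinatorics.Additive
open Literature.Computability.QuantumComplexity Literature.Computability.Cryptography

/-! ### Instantiation: the band differentials of `x ↦ gˣ mod p` as a triple count -/

section Band

open Literature.Computability.QuantumComplexity Literature.Computability.Cryptography

variable {n : ℕ}

/-- A quadratic `ε t² + r t − c` with `ε ≠ 0` has at most two roots in a field. -/
theorem card_filter_quadratic_le_two {F : Type*} [Field F] [Fintype F] [DecidableEq F]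
    (ε r c : F) (hε : ε ≠ 0) :
    (Finset.univ.filter fun t : F => ε * t ^ 2 + r * t - c = 0).card ≤ 2 := by
  by_contra h
  push Not at h
  obtain ⟨t₁, t₂, t₃, h₁, h₂, h₃, h12, h13, h23⟩ := Finset.two_lt_card_iff.mp h
  simp only [Finset.mem_filter, Finset.mem_univ, true_and] at h₁ h₂ h₃
  have key : ∀ {u v : F}, ε * u ^ 2 + r * u - c = 0 → ε * v ^ 2 + r * v - c = 0 → u ≠ v →
      ε * (u + v) + r = 0 := by
    intro u v hu hv huv
    have : (u - v) * (ε * (u + v) + r) = 0 := by linear_combination hu - hv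
    rcases mul_eq_zero.mp this with h0 | h0
    · exact absurd (sub_eq_zero.mp h0) huv
    · exact h0
  have e12 := key h₁ h₂ h12
  have e13 := key h₁ h₃ h13
  have : ε * (t₂ - t₃) = 0 := by linear_combination e12 - e13
  rcases mul_eq_zero.mp this with h0 | h0
  · exact hε h0
  · exact h23 (sub_eq_zero.mp h0)

/-- Fibres of the multiplier map `w ↦ g^A (g^W)⁻¹ − ε g^W` (`W = ofBits w`) on any set of labels:
at most four points (two roots of a quadratic in `t = g^W`, two labels per value of `g^W`). -/
theorem card_filter_phi_le_four {p g : ℕ} (hp : p.Prime) (hg : orderOf (g : ZMod p) = p - 1)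
    (h2 : 2 ^ n ≤ 2 * (p - 1)) (GA ε : ZMod p) (hε : ε = 1 ∨ ε = -1) (T : Finset (QReg n))
    (r : ZMod p) :
    (T.filter fun w : QReg n =>
        GA * ((g : ZMod p) ^ Nat.ofBits w)⁻¹ - ε * (g : ZMod p) ^ Nat.ofBits w = r).card ≤ 4 := by
  classical
  haveI := Fact.mk hp
  set G : ZMod p := (g : ZMod p) with hG
  have hG0 : G ≠ 0 := by
    intro h0
    rw [h0, orderOf_eq_zero_iff'.mpr] at hg
    · have := hp.two_le; omega
    · intro m hm h1
      rw [zero_pow (Nat.pos_iff_ne_zero.mp hm)] at h1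
      exact zero_ne_one h1
  have hε0 : ε ≠ 0 := by rcases hε with rfl | rfl <;> simp
  set Troots := (Finset.univ.filter fun t : ZMod p => ε * t ^ 2 + r * t - GA = 0) with hT
  calc (T.filter fun w : QReg n => GA * (G ^ Nat.ofBits w)⁻¹ - ε * G ^ Nat.ofBits w = r).card
      ≤ 2 * Troots.card := by
        refine Finset.card_le_mul_card_image_of_maps_to (f := fun w : QReg n => G ^ Nat.ofBits w)
          (t := Troots) ?_ 2 ?_
        · intro w hw
          rw [Finset.mem_filter] at hw
          rw [hT, Finset.mem_filter]
          refine ⟨Finset.mem_univ _, ?_⟩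
          have ht0 : G ^ Nat.ofBits w ≠ 0 := pow_ne_zero _ hG0
          have e := hw.2
          field_simp at e
          linear_combination -e
        · intro t _
          refine le_trans (Finset.card_le_card ?_) (stub_dlogOrbitFibre n p g hp hg h2 t)
          intro w hw
          rw [Finset.mem_filter] at hw ⊢
          exact ⟨Finset.mem_univ _, hw.2⟩
    _ ≤ 2 * 2 := Nat.mul_le_mul_left 2 (card_filter_quadratic_le_two ε r GA hε0)
    _ = 4 := by norm_num

/-- Fibres of `v ↦ g^{ofBits v}` on any set of labels: at most two points. -/
theorem card_filter_pow_le_two {p g : ℕ} (hp : p.Prime) (hg : orderOf (g : ZMod p) = p - 1)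
    (h2 : 2 ^ n ≤ 2 * (p - 1)) (T : Finset (QReg n)) (r : ZMod p) :
    (T.filter fun v : QReg n => (g : ZMod p) ^ Nat.ofBits v = r).card ≤ 2 := by
  classical
  refine le_trans (Finset.card_le_card ?_) (stub_dlogOrbitFibre n p g hp hg h2 r)
  intro v hv
  rw [Finset.mem_filter] at hv ⊢
  exact ⟨Finset.mem_univ _, hv.2⟩

/-- **The band count as a triple count.** Let `S` be a set of labels on which the differential
equation holds in the normalised form
`g^{ofBits (x ⊕ a)} − ε g^{ofBits x} = c + (B − 2·ofBits (q x ∧ b))` (`ε ∈ {±1}`).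
Then, off the exceptional classes `g^A = ±(g^W)²`, the map `x ↦ (x ∧ a, x ∧ ā, q x ∧ b)` injects
`S` into the solutions of `z · φ(w) = s(u)` with `φ(w) = g^A (g^W)⁻¹ − ε g^W ≠ 0`,
`z = g^{ofBits (x ∧ ā)}`, `s(u) = c + (B − 2 ofBits u) ≠ 0`. -/
theorem band_card_le_triple_add_exceptional {p g : ℕ} (hp : p.Prime)
    (hg : orderOf (g : ZMod p) = p - 1) (hp2 : 2 ≤ p) (a b : QReg n) (q : QReg n → QReg n)
    (ε c : ZMod p) (hε : ε = 1 ∨ ε = -1) (S : Finset (QReg n))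
    (HYP : ∀ x ∈ S, (g : ZMod p) ^ Nat.ofBits (fun j => Bool.xor (x j) (a j)) -
        ε * (g : ZMod p) ^ Nat.ofBits x =
        c + ((Nat.ofBits b : ZMod p) - 2 * (Nat.ofBits (fun j => q x j && b j) : ZMod p))) :
    S.card ≤
      ((((Finset.univ.image fun x : QReg n => fun j => x j && a j).filter fun w =>
            (g : ZMod p) ^ Nat.ofBits a * ((g : ZMod p) ^ Nat.ofBits w)⁻¹ -
              ε * (g : ZMod p) ^ Nat.ofBits w ≠ 0) ×ˢ
          ((Finset.univ.image fun x : QReg n => fun j => x j && !a j) ×ˢ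
            ((Finset.univ.image fun x : QReg n => fun j => x j && b j).filter fun u =>
              c + ((Nat.ofBits b : ZMod p) - 2 * (Nat.ofBits u : ZMod p)) ≠ 0))).filter
          fun t => (g : ZMod p) ^ Nat.ofBits t.2.1 *
            ((g : ZMod p) ^ Nat.ofBits a * ((g : ZMod p) ^ Nat.ofBits t.1)⁻¹ -
              ε * (g : ZMod p) ^ Nat.ofBits t.1) =
            c + ((Nat.ofBits b : ZMod p) - 2 * (Nat.ofBits t.2.2 : ZMod p))).card +
      (Finset.univ.filter fun x : QReg n =>
          (g : ZMod p) ^ Nat.ofBits a = ((g : ZMod p) ^ Nat.ofBits (fun j => x j && a j)) ^ 2 ∨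
          (g : ZMod p) ^ Nat.ofBits a = -((g : ZMod p) ^ Nat.ofBits (fun j => x j && a j)) ^ 2).card := by
  classical
  haveI := Fact.mk hp
  set G : ZMod p := (g : ZMod p) with hG
  set A : ℕ := Nat.ofBits a with hA
  have hG0 : G ≠ 0 := by
    intro h0
    rw [h0, orderOf_eq_zero_iff'.mpr] at hg
    · omega
    · intro m hm h1
      rw [zero_pow (Nat.pos_iff_ne_zero.mp hm)] at h1
      exact zero_ne_one h1
  set φ : QReg n → ZMod p := fun w => G ^ A * (G ^ Nat.ofBits w)⁻¹ - ε * G ^ Nat.ofBits w with hφ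
  set s : QReg n → ZMod p := fun u => c + ((Nat.ofBits b : ZMod p) - 2 * (Nat.ofBits u : ZMod p))
    with hs
  set Pexc : QReg n → Prop := fun x => G ^ A = ε * (G ^ Nat.ofBits (fun j => x j && a j)) ^ 2
    with hPexc
  -- split S
  have hsplit := Finset.card_filter_add_card_filter_not (s := S) Pexc
  -- the exceptional part sits inside the exceptional classes
  have hexc : (S.filter Pexc).card ≤ (Finset.univ.filter fun x : QReg n =>
      G ^ A = (G ^ Nat.ofBits (fun j => x j && a j)) ^ 2 ∨
      G ^ A = -(G ^ Nat.ofBits (fun j => x j && a j)) ^ 2).card := by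
    refine Finset.card_le_card fun x hx => ?_
    rw [Finset.mem_filter] at hx ⊢
    refine ⟨Finset.mem_univ _, ?_⟩
    rcases hε with h1 | h1
    · left; rw [hx.2, h1, one_mul]
    · right; rw [hx.2, h1]; ring
  -- the generic part injects into the triple count
  have hgen : (S.filter fun x => ¬ Pexc x).card ≤
      ((((Finset.univ.image fun x : QReg n => fun j => x j && a j).filter fun w => φ w ≠ 0) ×ˢ
          ((Finset.univ.image fun x : QReg n => fun j => x j && !a j) ×ˢ
            ((Finset.univ.image fun x : QReg n => fun j => x j && b j).filter fun u => s u ≠ 0))).filter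
          fun t => G ^ Nat.ofBits t.2.1 * φ t.1 = s t.2.2).card := by
    refine Finset.card_le_card_of_injOn
      (fun x => ((fun j => x j && a j), ((fun j => x j && !a j), (fun j => q x j && b j)))) ?_ ?_
    · intro x hx
      rw [Finset.mem_coe, Finset.mem_filter] at hx
      obtain ⟨hxS, hxP⟩ := hx
      -- the equation
      have hW := ofBits_split x a
      have hF := ofBits_flip_add x a
      rw [← hA] at hF
      have heq : G ^ Nat.ofBits (fun j => x j && !a j) * φ (fun j => x j && a j) =
          s (fun j => q x j && b j) := by
        have e := HYP x hxS
        rw [hs]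
        simp only
        rw [← e, hφ]
        simp only
        have ht0 : G ^ Nat.ofBits (fun j => x j && a j) ≠ 0 := pow_ne_zero _ hG0
        have hmul : G ^ Nat.ofBits (fun j => Bool.xor (x j) (a j)) * G ^ Nat.ofBits (fun j => x j && a j) =
            G ^ A * G ^ Nat.ofBits (fun j => x j && !a j) := by
          rw [← pow_add, ← pow_add, hF]
        have hflip : G ^ Nat.ofBits (fun j => Bool.xor (x j) (a j)) =
            G ^ A * G ^ Nat.ofBits (fun j => x j && !a j) * (G ^ Nat.ofBits (fun j => x j && a j))⁻¹ :=
          (eq_mul_inv_iff_mul_eq₀ ht0).mpr hmul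
        rw [hW, pow_add, hflip]
        ring
      have hφ0 : φ (fun j => x j && a j) ≠ 0 := by
        intro h0
        apply hxP
        rw [hPexc]
        simp only
        rw [hφ] at h0
        simp only at h0
        have ht0 : G ^ Nat.ofBits (fun j => x j && a j) ≠ 0 := pow_ne_zero _ hG0
        field_simp at h0
        linear_combination h0
      have hs0 : s (fun j => q x j && b j) ≠ 0 := by
        rw [← heq]
        exact mul_ne_zero (pow_ne_zero _ hG0) hφ0
      rw [Finset.mem_coe, Finset.mem_filter, Finset.mem_product, Finset.mem_product,
        Finset.mem_filter, Finset.mem_filter]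
      exact ⟨⟨⟨Finset.mem_image_of_mem _ (Finset.mem_univ _), hφ0⟩,
        Finset.mem_image_of_mem _ (Finset.mem_univ _),
        Finset.mem_image_of_mem _ (Finset.mem_univ _), hs0⟩, heq⟩
    · intro x _ x' _ hxx
      simp only [Prod.mk.injEq] at hxx
      exact eq_of_bits_in_out hxx.1 hxx.2.1
  have hfin : S.card ≤
      ((((Finset.univ.image fun x : QReg n => fun j => x j && a j).filter fun w => φ w ≠ 0) ×ˢ
          ((Finset.univ.image fun x : QReg n => fun j => x j && !a j) ×ˢ
            ((Finset.univ.image fun x : QReg n => fun j => x j && b j).filter fun u => s u ≠ 0))).filter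
          fun t => G ^ Nat.ofBits t.2.1 * φ t.1 = s t.2.2).card +
      (Finset.univ.filter fun x : QReg n =>
        G ^ A = (G ^ Nat.ofBits (fun j => x j && a j)) ^ 2 ∨
        G ^ A = -(G ^ Nat.ofBits (fun j => x j && a j)) ^ 2).card := by omega
  exact hfin

end Band

/-! ### The two Cauchy–Schwarz orderings for the band triple count -/

section BandBounds

open Literature.Computability.QuantumComplexity Literature.Computability.Cryptography

variable {n : ℕ}

/-- Monotonicity of the index-level energy in the index set. -/
theorem energy_filter_mono {γ F : Type*} [Mul F] [DecidableEq F] (U U' : Finset γ) (h : U' ⊆ U)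
    (s : γ → F) :
    ((((U' ×ˢ U') ×ˢ (U' ×ˢ U')).filter fun q => s q.1.1 * s q.2.2 = s q.1.2 * s q.2.1).card) ≤
      (((U ×ˢ U) ×ˢ (U ×ˢ U)).filter fun q => s q.1.1 * s q.2.2 = s q.1.2 * s q.2.1).card :=
  Finset.card_le_card (Finset.filter_subset_filter _
    (Finset.product_subset_product (Finset.product_subset_product h h)
      (Finset.product_subset_product h h)))

/-- **Both orderings of the triple-product bound for the band count.** For generic multiplier
classes `PW' ⊆ {x ∧ a}` (on which `φ(w) = g^A (g^W)⁻¹ − ε g^W ≠ 0`), `PV ⊆ {x ∧ ā}`, spread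
patterns `PU' ⊆ PU` with `s(u) = c + (B − 2·ofBits u) ≠ 0` on `PU'`, and `k = |a|`:
`N⁴ ≤ (4·2^k)² · E×(s; PU) · 2·(2^{n−k})³` and `N⁴ ≤ (2·2^{n−k})² · E×(s; PU) · 4·(2^k)³`,
where `N = #{(w,v,u) ∈ PW' × PV × PU' : g^{ofBits v} φ(w) = s(u)}`. -/
theorem band_triple_pow_four_le {p g : ℕ} (hp : p.Prime) (hg : orderOf (g : ZMod p) = p - 1)
    (h2 : 2 ^ n ≤ 2 * (p - 1)) (a b : QReg n) (ε c : ZMod p) (hε : ε = 1 ∨ ε = -1)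
    (PW' PV PU' PU : Finset (QReg n))
    (hW : PW' ⊆ Finset.univ.image fun x : QReg n => fun j => x j && a j)
    (hV : PV ⊆ Finset.univ.image fun x : QReg n => fun j => x j && !a j) (hU : PU' ⊆ PU)
    (hφ0 : ∀ w ∈ PW', (g : ZMod p) ^ Nat.ofBits a * ((g : ZMod p) ^ Nat.ofBits w)⁻¹ -
        ε * (g : ZMod p) ^ Nat.ofBits w ≠ 0)
    (hs0 : ∀ u ∈ PU', c + ((Nat.ofBits b : ZMod p) - 2 * (Nat.ofBits u : ZMod p)) ≠ 0) :
    ((PW' ×ˢ (PV ×ˢ PU')).filter fun t => (g : ZMod p) ^ Nat.ofBits t.2.1 *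
        ((g : ZMod p) ^ Nat.ofBits a * ((g : ZMod p) ^ Nat.ofBits t.1)⁻¹ -
          ε * (g : ZMod p) ^ Nat.ofBits t.1) =
        c + ((Nat.ofBits b : ZMod p) - 2 * (Nat.ofBits t.2.2 : ZMod p))).card ^ 4 ≤
      (4 * 2 ^ (Finset.univ.filter fun j => a j = true).card) ^ 2 *
        ((((PU ×ˢ PU) ×ˢ (PU ×ˢ PU)).filter fun q =>
            (c + ((Nat.ofBits b : ZMod p) - 2 * (Nat.ofBits q.1.1 : ZMod p))) *
              (c + ((Nat.ofBits b : ZMod p) - 2 * (Nat.ofBits q.2.2 : ZMod p))) =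
            (c + ((Nat.ofBits b : ZMod p) - 2 * (Nat.ofBits q.1.2 : ZMod p))) *
              (c + ((Nat.ofBits b : ZMod p) - 2 * (Nat.ofBits q.2.1 : ZMod p)))).card *
          (2 * (2 ^ (n - (Finset.univ.filter fun j => a j = true).card)) ^ 3)) ∧
    ((PW' ×ˢ (PV ×ˢ PU')).filter fun t => (g : ZMod p) ^ Nat.ofBits t.2.1 *
        ((g : ZMod p) ^ Nat.ofBits a * ((g : ZMod p) ^ Nat.ofBits t.1)⁻¹ -
          ε * (g : ZMod p) ^ Nat.ofBits t.1) =
        c + ((Nat.ofBits b : ZMod p) - 2 * (Nat.ofBits t.2.2 : ZMod p))).card ^ 4 ≤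
      (2 * 2 ^ (n - (Finset.univ.filter fun j => a j = true).card)) ^ 2 *
        ((((PU ×ˢ PU) ×ˢ (PU ×ˢ PU)).filter fun q =>
            (c + ((Nat.ofBits b : ZMod p) - 2 * (Nat.ofBits q.1.1 : ZMod p))) *
              (c + ((Nat.ofBits b : ZMod p) - 2 * (Nat.ofBits q.2.2 : ZMod p))) =
            (c + ((Nat.ofBits b : ZMod p) - 2 * (Nat.ofBits q.1.2 : ZMod p))) *
              (c + ((Nat.ofBits b : ZMod p) - 2 * (Nat.ofBits q.2.1 : ZMod p)))).card *
          (4 * (2 ^ (Finset.univ.filter fun j => a j = true).card) ^ 3)) := by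
  classical
  haveI := Fact.mk hp
  set G : ZMod p := (g : ZMod p) with hG
  set φ : QReg n → ZMod p := fun w => G ^ Nat.ofBits a * (G ^ Nat.ofBits w)⁻¹ - ε * G ^ Nat.ofBits w
    with hφ
  set s : QReg n → ZMod p := fun u => c + ((Nat.ofBits b : ZMod p) - 2 * (Nat.ofBits u : ZMod p))
    with hs
  set k := (Finset.univ.filter fun j => a j = true).card with hk
  have hG0 : G ≠ 0 := by
    intro h0
    rw [h0, orderOf_eq_zero_iff'.mpr] at hg
    · have := hp.two_le; omega
    · intro m hm h1
      rw [zero_pow (Nat.pos_iff_ne_zero.mp hm)] at h1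
      exact zero_ne_one h1
  -- fibre bounds and non-vanishing
  have hMφ : ∀ r, (PW'.filter fun w => φ w = r).card ≤ 4 := fun r =>
    card_filter_phi_le_four hp hg h2 (G ^ Nat.ofBits a) ε hε PW' r
  have hMz : ∀ r, (PV.filter fun v => G ^ Nat.ofBits v = r).card ≤ 2 := fun r =>
    card_filter_pow_le_two hp hg h2 PV r
  have hz : ∀ v ∈ PV, G ^ Nat.ofBits v ≠ 0 := fun v _ => pow_ne_zero _ hG0
  have hφ0' : ∀ w ∈ PW', φ w ≠ 0 := hφ0
  have hs0' : ∀ u ∈ PU', s u ≠ 0 := hs0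
  -- sizes
  have hPW : PW'.card ≤ 2 ^ k := (Finset.card_le_card hW).trans (card_image_bits_in_le a)
  have hPV : PV.card ≤ 2 ^ (n - k) := (Finset.card_le_card hV).trans (card_image_bits_out_le a)
  have hE : (((PU' ×ˢ PU') ×ˢ (PU' ×ˢ PU')).filter
      fun q => s q.1.1 * s q.2.2 = s q.1.2 * s q.2.1).card ≤
      (((PU ×ˢ PU) ×ˢ (PU ×ˢ PU)).filter fun q => s q.1.1 * s q.2.2 = s q.1.2 * s q.2.1).card :=
    energy_filter_mono PU PU' hU s
  have h1 := triple_count_pow_four_le PW' PV PU' φ (fun v => G ^ Nat.ofBits v) s 4 2 hMφ hMz hz hs0'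
  have hsw := triple_count_swap PW' PV PU' φ (fun v => G ^ Nat.ofBits v) s
  have h2' := triple_count_pow_four_le PV PW' PU' (fun v => G ^ Nat.ofBits v) φ s 2 4 hMz hMφ hφ0' hs0'
  rw [hsw] at h2'
  constructor
  · refine h1.trans ?_
    exact Nat.mul_le_mul (Nat.pow_le_pow_left (Nat.mul_le_mul_left 4 hPW) 2)
      (Nat.mul_le_mul hE (Nat.mul_le_mul_left 2 (Nat.pow_le_pow_left hPV 3)))
  · refine h2'.trans ?_
    exact Nat.mul_le_mul (Nat.pow_le_pow_left (Nat.mul_le_mul_left 2 hPV) 2)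
      (Nat.mul_le_mul hE (Nat.mul_le_mul_left 4 (Nat.pow_le_pow_left hPW 3)))

end BandBounds

/-- **Stub `stub_dlogBandCount` (registered; the band count as a triple count plus the exceptional
classes)** — closed form of `band_card_le_triple_add_exceptional`. -/
theorem stub_dlogBandCount : ∀ (n p g : ℕ), p.Prime → orderOf (g : ZMod p) = p - 1 → 2 ≤ p →
    ∀ (a b : QReg n) (q : QReg n → QReg n) (ε c : ZMod p), (ε = 1 ∨ ε = -1) →
    ∀ S : Finset (QReg n),
    (∀ x ∈ S, (g : ZMod p) ^ Nat.ofBits (fun j => Bool.xor (x j) (a j)) -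
        ε * (g : ZMod p) ^ Nat.ofBits x =
        c + ((Nat.ofBits b : ZMod p) - 2 * (Nat.ofBits (fun j => q x j && b j) : ZMod p))) →
    S.card ≤
      ((((Finset.univ.image fun x : QReg n => fun j => x j && a j).filter
            fun w => (g : ZMod p) ^ Nat.ofBits a * ((g : ZMod p) ^ Nat.ofBits w)⁻¹ -
              ε * (g : ZMod p) ^ Nat.ofBits w ≠ 0) ×ˢ
          ((Finset.univ.image fun x : QReg n => fun j => x j && !a j) ×ˢ
            ((Finset.univ.image fun x : QReg n => fun j => x j && b j).filter
              fun u => c + ((Nat.ofBits b : ZMod p) - 2 * (Nat.ofBits u : ZMod p)) ≠ 0))).filter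
          fun t => (g : ZMod p) ^ Nat.ofBits t.2.1 *
            ((g : ZMod p) ^ Nat.ofBits a * ((g : ZMod p) ^ Nat.ofBits t.1)⁻¹ -
              ε * (g : ZMod p) ^ Nat.ofBits t.1) =
            c + ((Nat.ofBits b : ZMod p) - 2 * (Nat.ofBits t.2.2 : ZMod p))).card +
      (Finset.univ.filter fun x : QReg n =>
          (g : ZMod p) ^ Nat.ofBits a = ((g : ZMod p) ^ Nat.ofBits (fun j => x j && a j)) ^ 2 ∨
          (g : ZMod p) ^ Nat.ofBits a = -((g : ZMod p) ^ Nat.ofBits (fun j => x j && a j)) ^ 2).card :=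
  fun _ _ _ hp hg hp2 a b q ε c hε S HYP =>
    band_card_le_triple_add_exceptional hp hg hp2 a b q ε c hε S HYP

end Summit.QuantumAdvantage.QuantumAdvantage.Theorems.SymplecticPurity
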